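import Literature.Topology.FourManifolds.MilnorFlowSymmetry
import Mathlib.Analysis.Convex.SpecificFunctions.Basic
import HarnessLib

/-!
# Passage through Milnor's model of a critical point: levels, exits and entrances along the model flow

Topic `Literature/Topology/FourManifolds` (support file for the two-field handle-extension
endgame of `stmt-SmoothPoincare4-15190`, after `MilnorFlowSymmetry.lean`).  Everything here is
in the model space `ℝᵐ` and **proved**; no definitions.

Milnor, *Lectures on the h-cobordism theorem* (1965), proof of Thm. 3.12 (PDF p. 18): along the
model trajectory `Φ_t(u) = (e^{-t} x⃗, e^{t} y⃗)` (`Literature.Topology.FourManifolds.milnorFlow`)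
of the field `(-x⃗, y⃗)` one has `|x⃗|²(t) = e^{-2t}|x⃗|²`, `|y⃗|²(t) = e^{2t}|y⃗|²`, so that

* the product `|x⃗|² |y⃗|²` is constant (`sqSumLT_mul_sqSumGE_milnorFlow`) and the level
  `Q = -|x⃗|² + |y⃗|²` is continuous and monotone in `t`;
* **exit**: if `y⃗ ≠ 0`, every level `L' ≥ Q(u)` is reached at some time `t ≥ 0`
  (`exists_milnorQuadratic_milnorFlow_eq_of_le`); **entrance**: if `x⃗ ≠ 0`, every level
  `L' ≤ Q(u)` is reached at some `t ≤ 0` (`…_of_ge`);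
* on the level `Q = L' > 0` one has `|x⃗|² ≤ |x⃗|²|y⃗|² / L'` and `‖·‖² = L' + 2|x⃗|²`
  (`sqSumLT_le_of_milnorQuadratic_eq`, `norm_sq_eq_of_milnorQuadratic_eq`), and symmetrically
  on `Q = -L'`: points leaving a small neighbourhood of the critical point cross the levels
  `±L'` close to the axes;
* `‖Φ_t u‖²` is a convex function of `t`, so along a passage it is bounded by its values at
  the ends (`norm_sq_milnorFlow_le_max`): passages between two points of a ball stay in the ball.

## References

* J. Milnor, *Lectures on the h-cobordism theorem*, notes by L. Siebenmann and J. Sondow (1965),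
  Def. 3.1 (PDF p. 12), proof of Thm. 3.12 (PDF p. 18). [MilnorHCobordism1965]
-/

open Set Function Filter
open scoped Topology

noncomputable section

namespace Literature.Topology.FourManifolds

variable {m : ℕ} (k : ℕ)

/-! ### The product `|x⃗|² |y⃗|²` and the level along the model flow -/

/-- `(e^{-t})² (e^{t})² = 1`. [folklore] -/
theorem exp_neg_sq_mul_exp_sq (t : ℝ) : Real.exp (-t) ^ 2 * Real.exp t ^ 2 = 1 := by
  rw [← mul_pow, ← Real.exp_add, neg_add_cancel, Real.exp_zero, one_pow]

/-- **The product `|x⃗|² |y⃗|²` is constant along the model flow.** [cite: MilnorHCobordism1965, proof of Thm. 3.12 (PDF p. 18)] -/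
theorem sqSumLT_mul_sqSumGE_milnorFlow (t : ℝ) (u : EuclideanSpace ℝ (Fin m)) :
    sqSumLT k (milnorFlow k t u) * sqSumGE k (milnorFlow k t u) = sqSumLT k u * sqSumGE k u := by
  rw [sqSumLT_milnorFlow, sqSumGE_milnorFlow]
  have h := exp_neg_sq_mul_exp_sq t
  calc Real.exp (-t) ^ 2 * sqSumLT k u * (Real.exp t ^ 2 * sqSumGE k u)
      = (Real.exp (-t) ^ 2 * Real.exp t ^ 2) * (sqSumLT k u * sqSumGE k u) := by ring
    _ = sqSumLT k u * sqSumGE k u := by rw [h, one_mul]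

/-- The level along the model flow: `Q(Φ_t u) = -e^{-2t}|x⃗|² + e^{2t}|y⃗|²`, a continuous
function of `t`. [folklore] -/
theorem continuous_milnorQuadratic_milnorFlow (u : EuclideanSpace ℝ (Fin m)) :
    Continuous fun t : ℝ => milnorQuadratic k (milnorFlow k t u) := by
  have h : (fun t : ℝ => milnorQuadratic k (milnorFlow k t u)) =
      fun t => -(Real.exp (-t) ^ 2 * sqSumLT k u) + Real.exp t ^ 2 * sqSumGE k u :=
    funext fun t => milnorQuadratic_milnorFlow k t u
  rw [h]
  fun_prop

/-- The norm along the model flow is a continuous function of `t`. [folklore] -/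
theorem continuous_norm_sq_milnorFlow (u : EuclideanSpace ℝ (Fin m)) :
    Continuous fun t : ℝ => ‖milnorFlow k t u‖ ^ 2 := by
  have h : (fun t : ℝ => ‖milnorFlow k t u‖ ^ 2) =
      fun t => Real.exp (-t) ^ 2 * sqSumLT k u + Real.exp t ^ 2 * sqSumGE k u :=
    funext fun t => by rw [← sqSumLT_add_sqSumGE k, sqSumLT_milnorFlow, sqSumGE_milnorFlow]
  rw [h]
  fun_prop

/-- **The level is monotone along the model flow.** [cite: MilnorHCobordism1965, Def. 3.1 (1) (PDF p. 12)] -/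
theorem monotone_milnorQuadratic_milnorFlow (u : EuclideanSpace ℝ (Fin m)) :
    Monotone fun t : ℝ => milnorQuadratic k (milnorFlow k t u) := by
  intro s t hst
  simp only [milnorQuadratic_milnorFlow]
  have ha := sqSumLT_nonneg k u
  have hb := sqSumGE_nonneg k u
  have h1 : Real.exp t ^ 2 ≥ Real.exp s ^ 2 := by
    have := Real.exp_le_exp.2 hst; have := Real.exp_pos s; nlinarith
  have h2 : Real.exp (-t) ^ 2 ≤ Real.exp (-s) ^ 2 := by
    have := Real.exp_le_exp.2 (neg_le_neg hst); have := Real.exp_pos (-t); nlinarith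
  nlinarith [mul_le_mul_of_nonneg_right h1 hb, mul_le_mul_of_nonneg_right h2 ha]

/-! ### Exits and entrances -/

/-- **Exit**: if `y⃗ ≠ 0`, every level `L' ≥ Q(u)` is reached along the forward model flow. [cite: MilnorHCobordism1965, proof of Thm. 3.12 (PDF p. 18)] -/
theorem exists_milnorQuadratic_milnorFlow_eq_of_le {u : EuclideanSpace ℝ (Fin m)} (hb : 0 < sqSumGE k u)
    {L' : ℝ} (hL : milnorQuadratic k u ≤ L') :
    ∃ t, 0 ≤ t ∧ milnorQuadratic k (milnorFlow k t u) = L' := by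
  set a := sqSumLT k u with ha
  set b := sqSumGE k u with hb'
  have ha0 : 0 ≤ a := sqSumLT_nonneg k u
  -- a large time at which the level exceeds `L'`
  set T : ℝ := (|L'| + a + b) / (2 * b) with hT
  have hT0 : 0 ≤ T := by positivity
  have hbig : L' ≤ milnorQuadratic k (milnorFlow k T u) := by
    rw [milnorQuadratic_milnorFlow]
    have h1 : 1 + 2 * T ≤ Real.exp T ^ 2 := by
      have h := Real.add_one_le_exp (2 * T)
      rw [show Real.exp T ^ 2 = Real.exp (2 * T) by rw [← Real.exp_nat_mul]; norm_num]
      linarith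
    have h2 : 2 * T * b = |L'| + a + b := by rw [hT]; field_simp
    have h3 : Real.exp (-T) ^ 2 ≤ 1 := by
      have h4 : Real.exp (-T) ≤ 1 := Real.exp_le_one_iff.2 (by linarith)
      have := Real.exp_pos (-T); nlinarith
    have h5 : Real.exp (-T) ^ 2 * a ≤ a := by nlinarith
    have h6 : (1 + 2 * T) * b ≤ Real.exp T ^ 2 * b := mul_le_mul_of_nonneg_right h1 hb.le
    have h7 := le_abs_self L'
    nlinarith
  have h0 : milnorQuadratic k (milnorFlow k 0 u) ≤ L' := by rw [milnorFlow_zero]; exact hL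
  obtain ⟨t, ht, htL⟩ := intermediate_value_Icc hT0 (continuous_milnorQuadratic_milnorFlow k u).continuousOn
    ⟨h0, hbig⟩
  exact ⟨t, ht.1, htL⟩

/-- **Entrance**: if `x⃗ ≠ 0`, every level `L' ≤ Q(u)` is reached along the backward model flow. [cite: MilnorHCobordism1965, proof of Thm. 3.12 (PDF p. 18)] -/
theorem exists_milnorQuadratic_milnorFlow_eq_of_ge {u : EuclideanSpace ℝ (Fin m)} (ha : 0 < sqSumLT k u)
    {L' : ℝ} (hL : L' ≤ milnorQuadratic k u) :
    ∃ t, t ≤ 0 ∧ milnorQuadratic k (milnorFlow k t u) = L' := by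
  set a := sqSumLT k u with ha'
  set b := sqSumGE k u with hb
  have hb0 : 0 ≤ b := sqSumGE_nonneg k u
  set T : ℝ := (|L'| + a + b) / (2 * a) with hT
  have hT0 : 0 ≤ T := by positivity
  have hsmall : milnorQuadratic k (milnorFlow k (-T) u) ≤ L' := by
    rw [milnorQuadratic_milnorFlow, neg_neg]
    have h1 : 1 + 2 * T ≤ Real.exp T ^ 2 := by
      have h := Real.add_one_le_exp (2 * T)
      rw [show Real.exp T ^ 2 = Real.exp (2 * T) by rw [← Real.exp_nat_mul]; norm_num]
      linarith
    have h2 : 2 * T * a = |L'| + a + b := by rw [hT]; field_simp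
    have h3 : Real.exp (-T) ^ 2 ≤ 1 := by
      have h4 : Real.exp (-T) ≤ 1 := Real.exp_le_one_iff.2 (by linarith)
      have := Real.exp_pos (-T); nlinarith
    have h5 : Real.exp (-T) ^ 2 * b ≤ b := by nlinarith
    have h6 : (1 + 2 * T) * a ≤ Real.exp T ^ 2 * a := mul_le_mul_of_nonneg_right h1 ha.le
    have h7 := neg_abs_le L'
    nlinarith
  have h0 : L' ≤ milnorQuadratic k (milnorFlow k 0 u) := by rw [milnorFlow_zero]; exact hL
  have hT0' : -T ≤ 0 := by linarith
  obtain ⟨t, ht, htL⟩ := intermediate_value_Icc hT0' (continuous_milnorQuadratic_milnorFlow k u).continuousOn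
    ⟨hsmall, h0⟩
  exact ⟨t, ht.2, htL⟩

/-! ### Points of the levels `Q = ±L'` -/

/-- **On the level `Q = L' > 0`, `|x⃗|² ≤ |x⃗|²|y⃗|² / L'`** (from `|x⃗|² (L' + |x⃗|²) = |x⃗|²|y⃗|²`). [folklore] -/
theorem sqSumLT_le_of_milnorQuadratic_eq {v : EuclideanSpace ℝ (Fin m)} {L' : ℝ} (hL : 0 < L')
    (hv : milnorQuadratic k v = L') : sqSumLT k v ≤ sqSumLT k v * sqSumGE k v / L' := by
  rw [milnorQuadratic_eq] at hv
  have ha := sqSumLT_nonneg k v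
  rw [le_div_iff₀ hL]
  have hB : sqSumGE k v = L' + sqSumLT k v := by linarith
  rw [hB]; nlinarith

/-- On the level `Q = L'`, `‖v‖² = L' + 2|x⃗|²`. [folklore] -/
theorem norm_sq_eq_of_milnorQuadratic_eq {v : EuclideanSpace ℝ (Fin m)} {L' : ℝ}
    (hv : milnorQuadratic k v = L') : ‖v‖ ^ 2 = L' + 2 * sqSumLT k v := by
  rw [milnorQuadratic_eq] at hv
  rw [← sqSumLT_add_sqSumGE k v]; linarith

/-- **On the level `Q = -L' < 0`, `|y⃗|² ≤ |x⃗|²|y⃗|² / L'`.** [folklore] -/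
theorem sqSumGE_le_of_milnorQuadratic_eq_neg {v : EuclideanSpace ℝ (Fin m)} {L' : ℝ} (hL : 0 < L')
    (hv : milnorQuadratic k v = -L') : sqSumGE k v ≤ sqSumLT k v * sqSumGE k v / L' := by
  rw [milnorQuadratic_eq] at hv
  have hb := sqSumGE_nonneg k v
  rw [le_div_iff₀ hL]
  have hA : sqSumLT k v = L' + sqSumGE k v := by linarith
  rw [hA]; nlinarith

/-- On the level `Q = -L'`, `‖v‖² = L' + 2|y⃗|²`. [folklore] -/
theorem norm_sq_eq_of_milnorQuadratic_eq_neg {v : EuclideanSpace ℝ (Fin m)} {L' : ℝ}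
    (hv : milnorQuadratic k v = -L') : ‖v‖ ^ 2 = L' + 2 * sqSumGE k v := by
  rw [milnorQuadratic_eq] at hv
  rw [← sqSumLT_add_sqSumGE k v]; linarith

/-! ### Convexity of the norm along the model flow -/

/-- `(e^{t})² = e^{2t}` (local helper). [folklore] -/
private theorem exp_sq_eq (t : ℝ) : Real.exp t ^ 2 = Real.exp (2 * t) := by
  rw [← Real.exp_nat_mul]; norm_num

/-- **`‖Φ_t u‖²` is bounded along `[T₁, T₂]` by its values at the ends** (it is the convex
function `e^{-2t}|x⃗|² + e^{2t}|y⃗|²`). [folklore] -/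
theorem norm_sq_milnorFlow_le_max {T₁ T₂ t : ℝ} (ht : t ∈ Icc T₁ T₂) (u : EuclideanSpace ℝ (Fin m)) :
    ‖milnorFlow k t u‖ ^ 2 ≤ max (‖milnorFlow k T₁ u‖ ^ 2) (‖milnorFlow k T₂ u‖ ^ 2) := by
  have hN : ∀ s : ℝ, ‖milnorFlow k s u‖ ^ 2 = Real.exp (2 * -s) * sqSumLT k u + Real.exp (2 * s) * sqSumGE k u :=
    fun s => by rw [← sqSumLT_add_sqSumGE k, sqSumLT_milnorFlow, sqSumGE_milnorFlow, exp_sq_eq, exp_sq_eq]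
  have ha := sqSumLT_nonneg k u
  have hb := sqSumGE_nonneg k u
  rcases eq_or_lt_of_le (ht.1.trans ht.2) with heq | hlt
  · -- degenerate interval
    have h1 : t = T₁ := le_antisymm (heq ▸ ht.2) ht.1
    rw [h1]; exact le_max_left _ _
  · -- `t = (1 - λ) T₁ + λ T₂`
    set μ : ℝ := (t - T₁) / (T₂ - T₁) with hμ
    have hd : 0 < T₂ - T₁ := sub_pos.2 hlt
    have hμ0 : 0 ≤ μ := div_nonneg (sub_nonneg.2 ht.1) hd.le
    have hμ1 : μ ≤ 1 := (div_le_one hd).2 (by linarith [ht.2])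
    have h1μ : 0 ≤ 1 - μ := sub_nonneg.2 hμ1
    have htμ : t = (1 - μ) * T₁ + μ * T₂ := by
      rw [hμ]; field_simp; ring
    have hsum : (1 - μ) + μ = 1 := by ring
    -- convexity of `exp` at the two exponents
    have hc1 : Real.exp (2 * t) ≤ (1 - μ) * Real.exp (2 * T₁) + μ * Real.exp (2 * T₂) := by
      have h := convexOn_exp.2 (mem_univ (2 * T₁)) (mem_univ (2 * T₂)) h1μ hμ0 hsum
      simp only [smul_eq_mul] at h
      rw [show 2 * t = (1 - μ) * (2 * T₁) + μ * (2 * T₂) by rw [htμ]; ring]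
      exact h
    have hc2 : Real.exp (2 * -t) ≤ (1 - μ) * Real.exp (2 * -T₁) + μ * Real.exp (2 * -T₂) := by
      have h := convexOn_exp.2 (mem_univ (2 * -T₁)) (mem_univ (2 * -T₂)) h1μ hμ0 hsum
      simp only [smul_eq_mul] at h
      rw [show 2 * -t = (1 - μ) * (2 * -T₁) + μ * (2 * -T₂) by rw [htμ]; ring]
      exact h
    rw [hN t, hN T₁, hN T₂]
    have hle : Real.exp (2 * -t) * sqSumLT k u + Real.exp (2 * t) * sqSumGE k u ≤
        (1 - μ) * (Real.exp (2 * -T₁) * sqSumLT k u + Real.exp (2 * T₁) * sqSumGE k u) +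
          μ * (Real.exp (2 * -T₂) * sqSumLT k u + Real.exp (2 * T₂) * sqSumGE k u) := by
      nlinarith [mul_le_mul_of_nonneg_right hc1 hb, mul_le_mul_of_nonneg_right hc2 ha]
    refine hle.trans ?_
    set X := Real.exp (2 * -T₁) * sqSumLT k u + Real.exp (2 * T₁) * sqSumGE k u
    set Y := Real.exp (2 * -T₂) * sqSumLT k u + Real.exp (2 * T₂) * sqSumGE k u
    have hX : X ≤ max X Y := le_max_left _ _
    have hY : Y ≤ max X Y := le_max_right _ _
    nlinarith

/-- **Passages between two points of a ball stay in the ball.** [folklore] -/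
theorem norm_milnorFlow_lt_of_endpoints {T₁ T₂ t R : ℝ} (hR : 0 ≤ R) (ht : t ∈ Icc T₁ T₂)
    {u : EuclideanSpace ℝ (Fin m)} (h₁ : ‖milnorFlow k T₁ u‖ < R) (h₂ : ‖milnorFlow k T₂ u‖ < R) :
    ‖milnorFlow k t u‖ < R := by
  have h := norm_sq_milnorFlow_le_max k ht u
  have h₁' : ‖milnorFlow k T₁ u‖ ^ 2 < R ^ 2 := pow_lt_pow_left₀ h₁ (norm_nonneg _) two_ne_zero
  have h₂' : ‖milnorFlow k T₂ u‖ ^ 2 < R ^ 2 := pow_lt_pow_left₀ h₂ (norm_nonneg _) two_ne_zero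
  have h3 : ‖milnorFlow k t u‖ ^ 2 < R ^ 2 := h.trans_lt (max_lt h₁' h₂')
  exact (pow_lt_pow_iff_left₀ (norm_nonneg _) hR two_ne_zero).1 h3

end Literature.Topology.FourManifolds
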